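import Summits.FinalStateConjecture.FinalStateConjecture.Theorems.PhotonSphereChannelsDuhamelC1

/-!
# Route PhotonSphereChannels — weighted estimates for the Duhamel operator on light-cone triangles (well-posedness, III)

Quantitative half of the Picard scheme for the Cauchy problem of `ψ_tt − ψ_xx + Vψ = 0`
(stub `stub_rwCauchy` of crux stmt-FinalStateConjecture-10045; `BlindnessInsidePhotonSphere`,
stmt-…-10049).  On the compact light-cone triangle `T_R = {|x| + |t| ≤ R}` every backward
characteristic triangle of a point of `T_R` stays in `T_R` (`mem_triangle_of_mem_uIoc`), so bounds
propagate; with the weight `e^{L|t|}` the Duhamel operator contracts: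

* `abs_integral_le_exp` — `|f| ≤ K e^{L|s|}` between `0` and `t` ⇒ `|∫₀ᵗ f| ≤ (K/L) e^{L|t|}`
  (`abs_integral_exp_mul_abs`: `|∫₀ᵗ e^{L|s|} ds| = (e^{L|t|} − 1)/L`);
* `duhamel_bound` — `|F| ≤ C e^{L|t|}` on `T_R` ⇒ `|D F| ≤ (RC/L) e^{L|t|}` on `T_R`;
* `fderiv_duhamel_bound` — `⇒ |∂D F(z)(v)| ≤ (|v₁|+|v₂|)(C/L) e^{L|t|}`;
* `fderiv_fderiv_duhamel_bound` — with `|∂₂F| ≤ C₁ e^{L|t|}` in addition,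
  `|∂²D F(z)(v)(w)| ≤ (|v₁|+|v₂|)(|w₁|+|w₂|)(C + C₁/L) e^{L|t|}`.

No new definitions. [folklore]
-/

namespace Summit.FinalStateConjecture.FinalStateConjecture.Theorems

open MeasureTheory Set Filter Topology intervalIntegral
open scoped ContDiff Interval

noncomputable section

namespace WaveEnergy

/-! ### Estimates for the Duhamel operator on light-cone triangles `{|x| + |t| ≤ R}` -/

section Estimates

variable {F D : ℝ × ℝ → ℝ}

/-- On the unordered interval between `0` and `t`: `|s| + |t − s| = |t|`. -/
theorem abs_add_abs_sub_of_mem_uIoc {s t : ℝ} (hs : s ∈ Ι (0 : ℝ) t) : |s| + |t - s| = |t| := by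
  rcases Set.mem_uIoc.1 hs with ⟨h1, h2⟩ | ⟨h1, h2⟩
  · rw [abs_of_pos h1, abs_of_nonneg (sub_nonneg.2 h2), abs_of_pos (h1.trans_le h2)]
    ring
  · rw [abs_of_nonpos h2, abs_of_nonpos (by linarith), abs_of_neg (h1.trans_le h2)]
    ring

/-- Points of the backward characteristic triangle of `(t, x)` stay in `{|x| + |t| ≤ R}`. -/
theorem mem_triangle_of_mem_uIoc {R t x s y : ℝ} (hz : |x| + |t| ≤ R) (hs : s ∈ Ι (0 : ℝ) t)
    (hy : |y - x| ≤ |t - s|) : |y| + |s| ≤ R := by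
  have h1 := abs_add_abs_sub_of_mem_uIoc hs
  have h2 : |y| ≤ |x| + |t - s| := by
    calc |y| = |x + (y - x)| := by ring_nf
      _ ≤ |x| + |y - x| := abs_add_le _ _
      _ ≤ |x| + |t - s| := by linarith
  linarith

/-- `|∫₀ᵗ e^{L|s|} ds| = (e^{L|t|} − 1)/L` for `L > 0`. -/
theorem abs_integral_exp_mul_abs {L : ℝ} (hL : 0 < L) (t : ℝ) :
    |∫ s in (0 : ℝ)..t, Real.exp (L * |s|)| = (Real.exp (L * |t|) - 1) / L := by
  rcases le_or_gt 0 t with ht | ht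
  · have heq : ∫ s in (0 : ℝ)..t, Real.exp (L * |s|) = ∫ s in (0 : ℝ)..t, Real.exp (L * s) := by
      refine intervalIntegral.integral_congr fun s hs => ?_
      rw [uIcc_of_le ht] at hs
      simp [abs_of_nonneg hs.1]
    rw [heq, intervalIntegral.integral_comp_mul_left (fun s => Real.exp s) hL.ne', integral_exp]
    simp only [mul_zero, Real.exp_zero, smul_eq_mul, abs_of_nonneg ht]
    rw [abs_of_nonneg (by
      apply mul_nonneg (inv_nonneg.2 hL.le)
      have : 1 ≤ Real.exp (L * t) := Real.one_le_exp (by positivity)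
      linarith)]
    field_simp
  · have heq : ∫ s in (0 : ℝ)..t, Real.exp (L * |s|) = ∫ s in (0 : ℝ)..t, Real.exp ((-L) * s) := by
      refine intervalIntegral.integral_congr fun s hs => ?_
      rw [uIcc_of_ge ht.le] at hs
      simp [abs_of_nonpos hs.2]
    rw [heq, intervalIntegral.integral_comp_mul_left (fun s => Real.exp s) (by linarith : (-L) ≠ 0),
      integral_exp]
    simp only [mul_zero, Real.exp_zero, smul_eq_mul, abs_of_neg ht]
    have h1 : 1 ≤ Real.exp (-L * t) := Real.one_le_exp (by nlinarith)
    rw [show (-L)⁻¹ * (Real.exp (-L * t) - 1) = -((Real.exp (-L * t) - 1) / L) by field_simp,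
      abs_neg, abs_of_nonneg (div_nonneg (by linarith) hL.le)]
    ring_nf

/-- **Weighted bound for characteristic integrals**: if `|f s| ≤ K e^{L|s|}` between `0` and `t`
then `|∫₀ᵗ f| ≤ (K/L) e^{L|t|}` (`L > 0`). -/
theorem abs_integral_le_exp {f : ℝ → ℝ} {t K L : ℝ} (hL : 0 < L) (hK : 0 ≤ K)
    (hb : ∀ s ∈ Ι (0 : ℝ) t, |f s| ≤ K * Real.exp (L * |s|)) :
    |∫ s in (0 : ℝ)..t, f s| ≤ K / L * Real.exp (L * |t|) := by
  have hgc : Continuous fun s : ℝ => K * Real.exp (L * |s|) := by fun_prop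
  have key : |∫ s in (0 : ℝ)..t, f s| ≤ |∫ s in (0 : ℝ)..t, K * Real.exp (L * |s|)| := by
    rcases le_or_gt 0 t with ht | ht
    · have h := intervalIntegral.norm_integral_le_of_norm_le (μ := volume) (f := f) ht
        (Eventually.of_forall fun s hs => by
          rw [Real.norm_eq_abs]
          exact hb s (by rwa [uIoc_of_le ht])) (hgc.intervalIntegrable _ _)
      rw [Real.norm_eq_abs] at h
      exact h.trans (le_abs_self _)
    · rw [intervalIntegral.integral_symm t 0, abs_neg,
        intervalIntegral.integral_symm t 0 (f := fun s => K * Real.exp (L * |s|)), abs_neg]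
      have h := intervalIntegral.norm_integral_le_of_norm_le (μ := volume) (f := f) ht.le
        (Eventually.of_forall fun s hs => by
          rw [Real.norm_eq_abs]
          exact hb s (by rwa [uIoc_of_ge ht.le])) (hgc.intervalIntegrable _ _)
      rw [Real.norm_eq_abs] at h
      exact h.trans (le_abs_self _)
  refine key.trans ?_
  rw [intervalIntegral.integral_const_mul, abs_mul, abs_of_nonneg hK, abs_integral_exp_mul_abs hL]
  have : K * ((Real.exp (L * |t|) - 1) / L) = K / L * Real.exp (L * |t|) - K / L := by ring
  rw [this]
  linarith [div_nonneg hK hL.le]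

/-- **`C⁰` bound for the Duhamel operator on the triangle `{|x| + |t| ≤ R}`**: if
`|F| ≤ C e^{L|t|}` there, then `|D F| ≤ (R C / L) e^{L|t|}` there (`L > 0`). [folklore] -/
theorem duhamel_bound (hF : Continuous F)
    (hD : ∀ t x, D (t, x) = (1 / 2) * ∫ s in (0 : ℝ)..t,
      ((∫ y in (0 : ℝ)..(x + (t - s)), F (s, y)) - ∫ y in (0 : ℝ)..(x - (t - s)), F (s, y)))
    {R C L : ℝ} (hL : 0 < L) (hC : 0 ≤ C)
    (hb : ∀ z : ℝ × ℝ, |z.2| + |z.1| ≤ R → |F z| ≤ C * Real.exp (L * |z.1|))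
    (z : ℝ × ℝ) (hz : |z.2| + |z.1| ≤ R) : |D z| ≤ R * C / L * Real.exp (L * |z.1|) := by
  obtain ⟨t, x⟩ := z
  simp only at hz ⊢
  have hR : 0 ≤ R := le_trans (by positivity) hz
  have hFi : ∀ a b : ℝ, ∀ s : ℝ, IntervalIntegrable (fun y => F (s, y)) volume a b := fun a b s =>
    (hF.comp (Continuous.prodMk_right s)).intervalIntegrable _ _
  rw [hD, abs_mul, abs_of_pos (by norm_num : (0 : ℝ) < 1 / 2)]
  have hinner : ∀ s ∈ Ι (0 : ℝ) t,
      |(∫ y in (0 : ℝ)..(x + (t - s)), F (s, y)) - ∫ y in (0 : ℝ)..(x - (t - s)), F (s, y)|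
        ≤ 2 * R * C * Real.exp (L * |s|) := by
    intro s hs
    rw [intervalIntegral.integral_interval_sub_left (hFi _ _ s) (hFi _ _ s)]
    have h1 := intervalIntegral.norm_integral_le_of_norm_le_const (a := x - (t - s)) (b := x + (t - s))
      (f := fun y => F (s, y)) (C := C * Real.exp (L * |s|)) (fun y hy => by
        rw [Real.norm_eq_abs]
        refine hb (s, y) (mem_triangle_of_mem_uIoc hz hs ?_)
        rcases Set.mem_uIoc.1 hy with ⟨h1, h2⟩ | ⟨h1, h2⟩
        · rw [abs_le]; constructor <;> linarith [le_abs_self (t - s), neg_abs_le (t - s)]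
        · rw [abs_le]; constructor <;> linarith [le_abs_self (t - s), neg_abs_le (t - s)])
    rw [Real.norm_eq_abs] at h1
    refine h1.trans ?_
    have h2 : |x + (t - s) - (x - (t - s))| ≤ 2 * R := by
      rw [show x + (t - s) - (x - (t - s)) = 2 * (t - s) by ring, abs_mul, abs_of_pos two_pos]
      have := abs_add_abs_sub_of_mem_uIoc hs
      linarith [abs_nonneg s, abs_nonneg x]
    have h3 : 0 ≤ C * Real.exp (L * |s|) := by positivity
    nlinarith
  have h := abs_integral_le_exp hL (by positivity : 0 ≤ 2 * R * C) hinner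
  calc 1 / 2 * |∫ s in (0 : ℝ)..t, ((∫ y in (0 : ℝ)..(x + (t - s)), F (s, y))
        - ∫ y in (0 : ℝ)..(x - (t - s)), F (s, y))|
      ≤ 1 / 2 * (2 * R * C / L * Real.exp (L * |t|)) := by gcongr
    _ = R * C / L * Real.exp (L * |t|) := by ring

/-- **`C¹` bound for the Duhamel operator on the triangle** (`F ∈ C¹`): if `|F| ≤ C e^{L|t|}` on
`{|x| + |t| ≤ R}` then `|∂D(z)(v)| ≤ (|v₁| + |v₂|)(C/L) e^{L|t|}` there. [folklore] -/
theorem fderiv_duhamel_bound (hF : ContDiff ℝ 1 F)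
    (hD : ∀ t x, D (t, x) = (1 / 2) * ∫ s in (0 : ℝ)..t,
      ((∫ y in (0 : ℝ)..(x + (t - s)), F (s, y)) - ∫ y in (0 : ℝ)..(x - (t - s)), F (s, y)))
    {R C L : ℝ} (hL : 0 < L) (hC : 0 ≤ C)
    (hb : ∀ z : ℝ × ℝ, |z.2| + |z.1| ≤ R → |F z| ≤ C * Real.exp (L * |z.1|))
    (z : ℝ × ℝ) (hz : |z.2| + |z.1| ≤ R) (v : ℝ × ℝ) :
    |fderiv ℝ D z v| ≤ (|v.1| + |v.2|) * (C / L) * Real.exp (L * |z.1|) := by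
  obtain ⟨t, x⟩ := z
  simp only at hz ⊢
  rw [fderiv_duhamel' hF (Φ := fun q => ∫ y in (0 : ℝ)..q.2, F (q.1, y)) (fun _ _ => rfl) hD t x v,
    abs_mul, abs_of_pos (by norm_num : (0 : ℝ) < 1 / 2)]
  have hseg : ∀ s ∈ Ι (0 : ℝ) t, ∀ c : ℝ, |c| ≤ 1 → |F (s, x + c * (t - s))| ≤ C * Real.exp (L * |s|) := by
    intro s hs c hc
    refine hb (s, x + c * (t - s)) (mem_triangle_of_mem_uIoc hz hs ?_)
    rw [show x + c * (t - s) - x = c * (t - s) by ring, abs_mul]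
    exact mul_le_of_le_one_left (abs_nonneg _) hc
  have hinner : ∀ s ∈ Ι (0 : ℝ) t,
      |F (s, x + (t - s)) * (v.1 + v.2) + F (s, x - (t - s)) * (v.1 - v.2)|
        ≤ 2 * ((|v.1| + |v.2|) * C) * Real.exp (L * |s|) := by
    intro s hs
    have h1 := hseg s hs 1 (by norm_num)
    have h2 := hseg s hs (-1) (by norm_num)
    simp only [one_mul, neg_one_mul, ← sub_eq_add_neg] at h1 h2
    have e0 : 0 ≤ Real.exp (L * |s|) := (Real.exp_pos _).le
    calc |F (s, x + (t - s)) * (v.1 + v.2) + F (s, x - (t - s)) * (v.1 - v.2)|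
        ≤ |F (s, x + (t - s))| * |v.1 + v.2| + |F (s, x - (t - s))| * |v.1 - v.2| := by
          refine (abs_add_le _ _).trans ?_
          rw [abs_mul, abs_mul]
      _ ≤ C * Real.exp (L * |s|) * (|v.1| + |v.2|) + C * Real.exp (L * |s|) * (|v.1| + |v.2|) := by
          gcongr
          · exact abs_add_le _ _
          · exact (abs_sub _ _)
      _ = 2 * ((|v.1| + |v.2|) * C) * Real.exp (L * |s|) := by ring
  have h := abs_integral_le_exp hL (by positivity) hinner
  calc 1 / 2 * |∫ s in (0 : ℝ)..t, (F (s, x + (t - s)) * (v.1 + v.2) + F (s, x - (t - s)) * (v.1 - v.2))|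
      ≤ 1 / 2 * (2 * ((|v.1| + |v.2|) * C) / L * Real.exp (L * |t|)) := by gcongr
    _ = (|v.1| + |v.2|) * (C / L) * Real.exp (L * |t|) := by ring

/-- **`C²` bound for the Duhamel operator on the triangle** (`F ∈ C¹`): if `|F| ≤ C e^{L|t|}` and
`|∂₂F| ≤ C₁ e^{L|t|}` on `{|x| + |t| ≤ R}` then
`|∂²D(z)(v)(w)| ≤ (|v₁|+|v₂|)(|w₁|+|w₂|)(C + C₁/L) e^{L|t|}` there. [folklore] -/
theorem fderiv_fderiv_duhamel_bound (hF : ContDiff ℝ 1 F)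
    (hD : ∀ t x, D (t, x) = (1 / 2) * ∫ s in (0 : ℝ)..t,
      ((∫ y in (0 : ℝ)..(x + (t - s)), F (s, y)) - ∫ y in (0 : ℝ)..(x - (t - s)), F (s, y)))
    {R C C₁ L : ℝ} (hL : 0 < L) (hC₁ : 0 ≤ C₁)
    (hb : ∀ z : ℝ × ℝ, |z.2| + |z.1| ≤ R → |F z| ≤ C * Real.exp (L * |z.1|))
    (hb1 : ∀ z : ℝ × ℝ, |z.2| + |z.1| ≤ R → |fderiv ℝ F z (0, 1)| ≤ C₁ * Real.exp (L * |z.1|))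
    (z : ℝ × ℝ) (hz : |z.2| + |z.1| ≤ R) (v w : ℝ × ℝ) :
    |fderiv ℝ (fderiv ℝ D) z v w|
      ≤ (|v.1| + |v.2|) * (|w.1| + |w.2|) * (C + C₁ / L) * Real.exp (L * |z.1|) := by
  obtain ⟨t, x⟩ := z
  simp only at hz ⊢
  rw [fderiv_fderiv_duhamel' hF (Φ := fun q => ∫ y in (0 : ℝ)..q.2, F (q.1, y)) (fun _ _ => rfl) hD t x v w]
  have hseg : ∀ s ∈ Ι (0 : ℝ) t, ∀ c : ℝ, |c| ≤ 1 →
      |fderiv ℝ F (s, x + c * (t - s)) (0, 1)| ≤ C₁ * Real.exp (L * |s|) := by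
    intro s hs c hc
    refine hb1 (s, x + c * (t - s)) (mem_triangle_of_mem_uIoc hz hs ?_)
    rw [show x + c * (t - s) - x = c * (t - s) by ring, abs_mul]
    exact mul_le_of_le_one_left (abs_nonneg _) hc
  have hI : ∀ c : ℝ, |c| ≤ 1 →
      |∫ s in (0 : ℝ)..t, fderiv ℝ F (s, x + c * (t - s)) (0, 1)| ≤ C₁ / L * Real.exp (L * |t|) :=
    fun c hc => abs_integral_le_exp hL hC₁ fun s hs => hseg s hs c hc
  have hIp := hI 1 (by norm_num)
  have hIm := hI (-1) (by norm_num)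
  have hF0 : |F (t, x)| ≤ C * Real.exp (L * |t|) := hb (t, x) hz
  set Ip := ∫ s in (0 : ℝ)..t, fderiv ℝ F (s, x + 1 * (t - s)) (0, 1)
  set Im := ∫ s in (0 : ℝ)..t, fderiv ℝ F (s, x + (-1) * (t - s)) (0, 1)
  have e0 : 0 ≤ Real.exp (L * |t|) := (Real.exp_pos _).le
  have hv : |v.1| ≤ |v.1| + |v.2| := by linarith [abs_nonneg v.2]
  have hw : |w.1| ≤ |w.1| + |w.2| := by linarith [abs_nonneg w.2]
  have h12 : |v.1 + v.2| ≤ |v.1| + |v.2| := abs_add_le _ _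
  have h12' : |v.2 - v.1| ≤ |v.1| + |v.2| := by rw [abs_sub_comm]; exact abs_sub _ _
  have w12 : |w.1 + w.2| ≤ |w.1| + |w.2| := abs_add_le _ _
  have w12' : |w.1 - w.2| ≤ |w.1| + |w.2| := abs_sub _ _
  calc |v.1 * w.1 * F (t, x) + 1 / 2 * ((v.1 + v.2) * (w.1 + w.2) * Ip + (v.2 - v.1) * (w.1 - w.2) * Im)|
      ≤ |v.1| * |w.1| * |F (t, x)| + 1 / 2 * (|v.1 + v.2| * |w.1 + w.2| * |Ip| + |v.2 - v.1| * |w.1 - w.2| * |Im|) := by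
        refine (abs_add_le _ _).trans ?_
        rw [abs_mul, abs_mul, abs_mul, abs_of_pos (by norm_num : (0 : ℝ) < 1 / 2)]
        gcongr
        refine (abs_add_le _ _).trans ?_
        rw [abs_mul, abs_mul, abs_mul, abs_mul]
    _ ≤ (|v.1| + |v.2|) * (|w.1| + |w.2|) * (C * Real.exp (L * |t|))
        + 1 / 2 * ((|v.1| + |v.2|) * (|w.1| + |w.2|) * (C₁ / L * Real.exp (L * |t|))
          + (|v.1| + |v.2|) * (|w.1| + |w.2|) * (C₁ / L * Real.exp (L * |t|))) := by
        gcongr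
    _ = (|v.1| + |v.2|) * (|w.1| + |w.2|) * (C + C₁ / L) * Real.exp (L * |t|) := by ring

end Estimates

end WaveEnergy

end

end Summit.FinalStateConjecture.FinalStateConjecture.Theorems
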